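/-
Origin: expansion seat `planner-pub-hodgecm-pv07-g2-0`, handover #2 2026-08-18T06:13:20Z (`HOME/pub-hodgecm-pv07-g2/lean/Pv07g2/DilationUnramified.lean`, md5 26f8e752, 232 lines);
landed by the gen-6 packager in gate run 24 as `HodgeCM/PerL34/LocalFactors/DilationUnramified.lean` (import ^import Pv07g2\.DilationModel\b→import HodgeCM.PerL34.LocalFactors.DilationModel ×1).
-/
/-
Copyright: HODGE-CM scale-up cell `pub-hodgecm`, unit `pub-hodgecm-pv07-g2` (DAG-node prover #07, gen 2), 2026-08-18.

# The dilation model at an UNRAMIFIED split place: the matrix coefficient of `φ⁰ = 1_{𝒪ⁿ}` on the shells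

PerL v5 Lemma 4.2(b), tex l. 629–630 (split `v ∉ S`): "`I_v(φ_v^0) = Σ_{n∈ℤ} χ'_v(ϖ)ⁿ ν_v(ϖ)ⁿ q_v^{-3|n|/2}
= L_v(1, χ'_v ν_v^{±1})·(1 - q_v^{-3})` (here the matrix coefficient of `φ⁰ = 1_{𝒪³}` under the dilation is
`ν_v(y) q_v^{-3|ord y|/2}`)".  This file PROVES the parenthesis in the dilation model of
`DilationModel.lean` (`(ω(y)f)(x) = ν(y)·δ(y)^{1/2}·f(yx)` on `L²(Fⁿ, μV)`, `δ` = the module `distribHaarChar`):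

* `ball_inter_preimage_smul_of_norm_le_one` / `_of_one_le_norm` : for `B = closedBall 0 ρ ⊂ Fⁿ` and `y : Fˣ`,
  `B ∩ y⁻¹B = B` if `‖y‖ ≤ 1` and `= y⁻¹B` if `1 ≤ ‖y‖`;
* `inner_ball_dilationRep_of_norm_le_one` / `_of_one_le_norm` : `⟪1_B, ω(y)1_B⟫ = ν(y)δ(y)^{1/2}·vol B`, resp.
  `= ν(y)δ(y)^{1/2}δ(y)⁻¹·vol B`;
* `distribHaarChar_zpow_mul_of_norm_eq_one` : `δ(ϖᵏu) = δ(ϖ)ᵏ` for `‖u‖ = 1` (shells);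
* **`splitIntegrand_f_eqOn_shell`** : for `ν, χ'` trivial on `𝒪^× = {‖u‖ = 1}` ("unramified"), `0 < ‖ϖ‖ < 1`, and
  every `k : ℤ`, the integrand of the datum `splitIntegrand μV 0 ρ μG ν χ'` (`φ⁰ = 1_B`) is CONSTANT on the shell
  `{y : ‖y‖ = ‖ϖ‖ᵏ}` with value `vol(B) · tᵏ⁺ · (χ'(ϖ)ν(ϖ))ᵏ`, `k⁺ = |k|`, where **`t := √δ_{Fⁿ}(ϖ)`**
  (`shellParam`); with `vol B = 1` this is pv09-g3's `UnramifiedPlaceData.hF` shape with `tOf q` replaced by `t`.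

RESIDUAL (honest, not discharged here): the arithmetic normalisation **`δ_{Fⁿ}(ϖ) = q⁻ⁿ`**, `q = #(𝒪/ϖ𝒪)`
(so `t = q^{-n/2} = tOf q` for `n = 3`) — the module of a uniformiser [Weil, *Basic Number Theory*, ch. I §2,
Prop. 2–3 and ch. I §4] — left to the shell-package seat (pv13-g3) by coset counting, or as a PRINT citation; and,
as for every file of this lineage, the identification of PerL's `ω_v|U(W_i)` with the dilation model (GAPS pv07-G1,
[MVW] LNM 1291 ch. 3 §III.1).  Nothing is cited; every hypothesis is displayed.  Imports: `DilationModel` only.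
-/
import Summits.HodgeConjecture.HodgeCM.PerL34.LocalFactors.DilationModel_2

set_option autoImplicit false

noncomputable section

open MeasureTheory MeasureTheory.Measure Set Metric Complex ComplexConjugate
open scoped ENNReal NNReal Pointwise InnerProductSpace

namespace HodgeCM
namespace PerL34
namespace LocalFactors
namespace DilationModel

section Unramified

variable {F : Type} [NormedField F] [IsUltrametricDist F] [ProperSpace F] {n : ℕ}

/-! ### §1  Ball geometry: `B ∩ y⁻¹B` for `B = closedBall 0 ρ` -/

omit [IsUltrametricDist F] [ProperSpace F] in
/-- (Ported verbatim from the HodgeCMPerL package; no docstring in the source.) -/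
theorem units_smul_eq (y : Fˣ) (x : Fin n → F) : y • x = (y : F) • x := rfl

omit [IsUltrametricDist F] [ProperSpace F] in
/-- (Ported verbatim from the HodgeCMPerL package; no docstring in the source.) -/
theorem ball_subset_preimage_smul {ρ : ℝ} (y : Fˣ) (hy : ‖(y : F)‖ ≤ 1) :
    closedBall (0 : Fin n → F) ρ ⊆ (fun x => y • x) ⁻¹' closedBall 0 ρ := by
  intro x hx
  rw [mem_closedBall_zero_iff] at hx
  rw [mem_preimage, mem_closedBall_zero_iff, units_smul_eq, norm_smul]
  calc ‖(y : F)‖ * ‖x‖ ≤ 1 * ‖x‖ := by gcongr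
    _ ≤ ρ := by rw [one_mul]; exact hx

omit [IsUltrametricDist F] [ProperSpace F] in
/-- (Ported verbatim from the HodgeCMPerL package; no docstring in the source.) -/
theorem preimage_smul_subset_ball {ρ : ℝ} (y : Fˣ) (hy : 1 ≤ ‖(y : F)‖) :
    (fun x => y • x) ⁻¹' closedBall (0 : Fin n → F) ρ ⊆ closedBall 0 ρ := by
  intro x hx
  rw [mem_preimage, mem_closedBall_zero_iff, units_smul_eq, norm_smul] at hx
  rw [mem_closedBall_zero_iff]
  calc ‖x‖ = 1 * ‖x‖ := (one_mul _).symm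
    _ ≤ ‖(y : F)‖ * ‖x‖ := by gcongr
    _ ≤ ρ := hx

omit [IsUltrametricDist F] [ProperSpace F] in
/-- `|y| ≤ 1 ⇒ 𝒪ⁿ ∩ y⁻¹𝒪ⁿ = 𝒪ⁿ` -/
theorem ball_inter_preimage_smul_of_norm_le_one (ρ : ℝ) (y : Fˣ) (hy : ‖(y : F)‖ ≤ 1) :
    closedBall (0 : Fin n → F) ρ ∩ (fun x => y • x) ⁻¹' closedBall 0 ρ = closedBall 0 ρ :=
  inter_eq_left.mpr (ball_subset_preimage_smul y hy)

omit [IsUltrametricDist F] [ProperSpace F] in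
/-- `|y| ≥ 1 ⇒ 𝒪ⁿ ∩ y⁻¹𝒪ⁿ = y⁻¹𝒪ⁿ` -/
theorem ball_inter_preimage_smul_of_one_le_norm (ρ : ℝ) (y : Fˣ) (hy : 1 ≤ ‖(y : F)‖) :
    closedBall (0 : Fin n → F) ρ ∩ (fun x => y • x) ⁻¹' closedBall 0 ρ
      = (fun x => y • x) ⁻¹' closedBall 0 ρ :=
  inter_eq_right.mpr (preimage_smul_subset_ball y hy)

/-! ### §2  The module on shells -/

/-- `δ(ϖᵏ·u) = δ(ϖ)ᵏ` for a norm-one unit `u` -/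
theorem distribHaarChar_zpow_mul_of_norm_eq_one (ϖ u : Fˣ) (hu : ‖(u : F)‖ = 1) (k : ℤ) :
    distribHaarChar (Fin n → F) (ϖ ^ k * u) = distribHaarChar (Fin n → F) ϖ ^ k := by
  rw [map_mul, map_zpow, distribHaarChar_eq_one_of_norm_eq_one n u hu, mul_one]

omit [IsUltrametricDist F] [ProperSpace F] in
/-- on the shell `‖y‖ = ‖ϖ‖ᵏ`: `y = ϖᵏ·u` with `‖u‖ = 1` -/
theorem exists_eq_zpow_mul_of_norm_eq (ϖ y : Fˣ) (k : ℤ) (hy : ‖(y : F)‖ = ‖(ϖ : F)‖ ^ k) :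
    ∃ u : Fˣ, ‖(u : F)‖ = 1 ∧ y = ϖ ^ k * u := by
  refine ⟨ϖ ^ (-k) * y, ?_, by group⟩
  have hϖ : ‖(ϖ : F)‖ ≠ 0 := norm_ne_zero_iff.mpr ϖ.ne_zero
  rw [Units.val_mul, Units.val_zpow_eq_zpow_val, norm_mul, norm_zpow, hy, ← zpow_add₀ hϖ, neg_add_cancel,
    zpow_zero]

variable (n) in
/-- the shell parameter **`t := √δ_{Fⁿ}(ϖ)`** (`= q^{-n/2}` once `δ_{Fⁿ}(ϖ) = q⁻ⁿ` is supplied) -/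
def shellParam (ϖ : Fˣ) : ℝ≥0 := NNReal.sqrt (distribHaarChar (Fin n → F) ϖ)

/-- (Ported verbatim from the HodgeCMPerL package; no docstring in the source.) -/
theorem shellParam_pos (ϖ : Fˣ) : 0 < shellParam n ϖ :=
  NNReal.sqrt_pos.mpr (distribHaarChar_pos)

/-- (Ported verbatim from the HodgeCMPerL package; no docstring in the source.) -/
theorem shellParam_sq (ϖ : Fˣ) : shellParam n ϖ ^ 2 = distribHaarChar (Fin n → F) ϖ :=
  NNReal.sq_sqrt _

/-- (Ported verbatim from the HodgeCMPerL package; no docstring in the source.) -/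
theorem shellParam_zpow (ϖ : Fˣ) (k : ℤ) :
    NNReal.sqrt (distribHaarChar (Fin n → F) ϖ ^ k) = shellParam n ϖ ^ k :=
  map_zpow₀ NNReal.sqrtHom _ k

/-- the weight on the shell: `ν(ϖᵏu)·δ(ϖᵏu)^{1/2} = ν(ϖ)ᵏ · tᵏ` for `ν` unramified -/
theorem weight_zpow_mul (ν : Fˣ →* Circle) (hν : ∀ u : Fˣ, ‖(u : F)‖ = 1 → ν u = 1) (ϖ u : Fˣ)
    (hu : ‖(u : F)‖ = 1) (k : ℤ) :
    weight (Fin n → F) ν (ϖ ^ k * u) = ((ν ϖ : ℂ) ^ k) * ((shellParam n ϖ : ℝ) : ℂ) ^ k := by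
  rw [weight, distribHaarChar_zpow_mul_of_norm_eq_one ϖ u hu k, map_mul, hν u hu, mul_one, map_zpow,
    shellParam_zpow, Circle.coe_zpow, NNReal.coe_zpow, Complex.ofReal_zpow]

/-! ### §3  The matrix coefficient of `1_B`, `B = closedBall 0 ρ`, in the two regimes -/

section Coefficient

variable [MeasurableSpace (Fin n → F)] [BorelSpace (Fin n → F)] (μV : Measure (Fin n → F)) [μV.IsAddHaarMeasure]
  (ρ : ℝ) (ν : Fˣ →* Circle)

/-- `vol(y⁻¹ s) = δ(y)⁻¹ vol(s)` in real form -/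
theorem measureReal_preimage_smul (y : Fˣ) (s : Set (Fin n → F)) :
    μV.real ((fun x => y • x) ⁻¹' s) = (((distribHaarChar (Fin n → F) y)⁻¹ : ℝ≥0) : ℝ) * μV.real s := by
  rw [measureReal_def, measure_preimage_smul_eq μV y s, ENNReal.toReal_mul, ENNReal.coe_toReal, measureReal_def]

/-- `⟪1_B, ω(y)1_B⟫ = ν(y)δ(y)^{1/2} · vol(B ∩ y⁻¹B)` (the general formula, `B = closedBall 0 ρ`) -/
theorem inner_ball_dilationRep (y : Fˣ) :
    ⟪ballIndicator μV 0 ρ, dilationRep μV ν y (ballIndicator μV 0 ρ)⟫_ℂ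
      = weight (Fin n → F) ν y
        * (μV.real (closedBall (0 : Fin n → F) ρ ∩ (fun x => y • x) ⁻¹' closedBall 0 ρ) : ℂ) := by
  rw [ballIndicator, inner_indicator_dilationRep]

/-- `|y| ≤ 1`: `⟪1_B, ω(y)1_B⟫ = ν(y)δ(y)^{1/2} · vol B` -/
theorem inner_ball_dilationRep_of_norm_le_one (y : Fˣ) (hy : ‖(y : F)‖ ≤ 1) :
    ⟪ballIndicator μV 0 ρ, dilationRep μV ν y (ballIndicator μV 0 ρ)⟫_ℂ
      = weight (Fin n → F) ν y * (μV.real (closedBall (0 : Fin n → F) ρ) : ℂ) := by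
  rw [inner_ball_dilationRep, ball_inter_preimage_smul_of_norm_le_one ρ y hy]

/-- `|y| ≥ 1`: `⟪1_B, ω(y)1_B⟫ = ν(y)δ(y)^{1/2} · δ(y)⁻¹ · vol B` -/
theorem inner_ball_dilationRep_of_one_le_norm (y : Fˣ) (hy : 1 ≤ ‖(y : F)‖) :
    ⟪ballIndicator μV 0 ρ, dilationRep μV ν y (ballIndicator μV 0 ρ)⟫_ℂ
      = weight (Fin n → F) ν y * ((((distribHaarChar (Fin n → F) y)⁻¹ : ℝ≥0) : ℝ) : ℂ)
        * (μV.real (closedBall (0 : Fin n → F) ρ) : ℂ) := by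
  rw [inner_ball_dilationRep, ball_inter_preimage_smul_of_one_le_norm ρ y hy, measureReal_preimage_smul,
    Complex.ofReal_mul, mul_assoc]

/-! ### §4  The integrand of `φ⁰ = 1_B` is constant on shells: `vol(B) · t^{|k|} · (χ'(ϖ)ν(ϖ))ᵏ` -/

attribute [local instance] unitsBorel borelSpace_units

variable (μG : Measure Fˣ) [μG.IsHaarMeasure] [μG.Regular] (χ' : Fˣ →* Circle)

/-- the shell `{y : ‖y‖ = ‖ϖ‖ᵏ}` (`= ϖᵏ𝒪^×`) -/
def shell (ϖ : Fˣ) (k : ℤ) : Set Fˣ := {y | ‖(y : F)‖ = ‖(ϖ : F)‖ ^ k}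

omit [IsUltrametricDist F] [ProperSpace F] in
/-- (Ported verbatim from the HodgeCMPerL package; no docstring in the source.) -/
theorem mem_shell_iff (ϖ : Fˣ) (k : ℤ) (y : Fˣ) : y ∈ shell ϖ k ↔ ‖(y : F)‖ = ‖(ϖ : F)‖ ^ k := Iff.rfl

omit [IsUltrametricDist F] [ProperSpace F] in
/-- (Ported verbatim from the HodgeCMPerL package; no docstring in the source.) -/
theorem zpow_mul_mem_shell (ϖ u : Fˣ) (hu : ‖(u : F)‖ = 1) (k : ℤ) : ϖ ^ k * u ∈ shell ϖ k := by
  rw [mem_shell_iff, Units.val_mul, Units.val_zpow_eq_zpow_val, norm_mul, norm_zpow, hu, mul_one]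

/-- the integrand of the unramified datum at `y = ϖᵏu`, `‖u‖ = 1`, BEFORE the case split:
`f(ϖᵏu) = ν(ϖ)ᵏ tᵏ · vol(B ∩ (ϖᵏu)⁻¹B) · χ'(ϖ)ᵏ` -/
theorem splitIntegrand_f_zpow_mul (ϖ u : Fˣ) (hu : ‖(u : F)‖ = 1)
    (hν : ∀ u : Fˣ, ‖(u : F)‖ = 1 → ν u = 1) (hχ : ∀ u : Fˣ, ‖(u : F)‖ = 1 → χ' u = 1) (k : ℤ) :
    (splitIntegrand μV 0 ρ μG ν χ').f (ϖ ^ k * u)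
      = (ν ϖ : ℂ) ^ k * ((shellParam n ϖ : ℝ) : ℂ) ^ k
        * (μV.real (closedBall (0 : Fin n → F) ρ ∩ (fun x => (ϖ ^ k * u) • x) ⁻¹' closedBall 0 ρ) : ℂ)
        * (χ' ϖ : ℂ) ^ k := by
  change ⟪ballIndicator μV 0 ρ, dilationRep μV ν (ϖ ^ k * u) (ballIndicator μV 0 ρ)⟫_ℂ
    * (χ' (ϖ ^ k * u) : ℂ) = _
  rw [inner_ball_dilationRep, weight_zpow_mul ν hν ϖ u hu k, map_mul, hχ u hu, mul_one, map_zpow,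
    Circle.coe_zpow]

/-- **The shell identity (tex l. 629–630, parenthesis), in the dilation model.**  For `0 < ‖ϖ‖ < 1`, `ν` and
`χ'` trivial on `𝒪^×`, and `k : ℤ`: on the shell `‖y‖ = ‖ϖ‖ᵏ` the integrand of `splitIntegrand μV 0 ρ μG ν χ'`
(`φ⁰ = 1_{closedBall 0 ρ}`) is the constant `vol(B) · t^{|k|} · (χ'(ϖ) ν(ϖ))ᵏ`, `t = shellParam n ϖ = √δ(ϖ)`. -/
theorem splitIntegrand_f_eqOn_shell (ϖ : Fˣ) (hϖ : ‖(ϖ : F)‖ < 1)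
    (hν : ∀ u : Fˣ, ‖(u : F)‖ = 1 → ν u = 1) (hχ : ∀ u : Fˣ, ‖(u : F)‖ = 1 → χ' u = 1) (k : ℤ) :
    EqOn (splitIntegrand μV 0 ρ μG ν χ').f
      (fun _ => (μV.real (closedBall (0 : Fin n → F) ρ) : ℂ) * ((shellParam n ϖ : ℝ) : ℂ) ^ k.natAbs
        * ((χ' ϖ : ℂ) * (ν ϖ : ℂ)) ^ k) (shell ϖ k) := by
  intro y hy
  obtain ⟨u, hu, rfl⟩ := exists_eq_zpow_mul_of_norm_eq ϖ y k hy
  have ht : ((shellParam n ϖ : ℝ) : ℂ) ≠ 0 := by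
    exact_mod_cast (shellParam_pos (n := n) ϖ).ne'
  rw [splitIntegrand_f_zpow_mul μV ρ ν μG χ' ϖ u hu hν hχ k]
  obtain ⟨m, rfl | rfl⟩ := Int.eq_nat_or_neg k
  · -- `k = m ≥ 0`: `‖y‖ ≤ 1`, `B ∩ y⁻¹B = B`
    have hy1 : ‖((ϖ ^ (m : ℤ) * u : Fˣ) : F)‖ ≤ 1 := by
      rw [(mem_shell_iff ϖ m _).1 (zpow_mul_mem_shell ϖ u hu m), zpow_natCast]
      exact pow_le_one₀ (norm_nonneg _) hϖ.le
    rw [ball_inter_preimage_smul_of_norm_le_one ρ _ hy1]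
    simp only [Int.natAbs_natCast, zpow_natCast]
    ring
  · -- `k = -m ≤ 0`: `‖y‖ ≥ 1`, `B ∩ y⁻¹B = y⁻¹B`, `vol = δ(y)⁻¹ vol B`, `δ(y) = t^{-2m}`
    have hy1 : 1 ≤ ‖((ϖ ^ (-(m : ℤ)) * u : Fˣ) : F)‖ := by
      rw [(mem_shell_iff ϖ (-(m : ℤ)) _).1 (zpow_mul_mem_shell ϖ u hu _), zpow_neg, zpow_natCast]
      exact one_le_inv₀ (pow_pos (norm_pos_iff.mpr ϖ.ne_zero) m) |>.mpr (pow_le_one₀ (norm_nonneg _) hϖ.le)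
    rw [ball_inter_preimage_smul_of_one_le_norm ρ _ hy1, measureReal_preimage_smul,
      distribHaarChar_zpow_mul_of_norm_eq_one ϖ u hu, ← shellParam_sq, mul_zpow]
    push_cast
    simp only [Int.natAbs_neg, Int.natAbs_natCast, zpow_neg, zpow_natCast, inv_inv]
    field_simp
    ring

/-- the same with the normalisation `vol(B) = 1` (`φ⁰` a unit vector): `f = t^{|k|} (χ'(ϖ)ν(ϖ))ᵏ` on the shell —
pv09-g3's `UnramifiedPlaceData.hF` shape with `tOf q ↦ t`. -/
theorem splitIntegrand_f_eqOn_shell_of_vol_one (ϖ : Fˣ) (hϖ : ‖(ϖ : F)‖ < 1)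
    (hν : ∀ u : Fˣ, ‖(u : F)‖ = 1 → ν u = 1) (hχ : ∀ u : Fˣ, ‖(u : F)‖ = 1 → χ' u = 1)
    (hvol : μV.real (closedBall (0 : Fin n → F) ρ) = 1) (k : ℤ) :
    EqOn (splitIntegrand μV 0 ρ μG ν χ').f
      (fun _ => ((shellParam n ϖ : ℝ) : ℂ) ^ k.natAbs * ((χ' ϖ : ℂ) * (ν ϖ : ℂ)) ^ k) (shell ϖ k) := by
  intro y hy
  rw [splitIntegrand_f_eqOn_shell μV ρ ν μG χ' ϖ hϖ hν hχ k hy, hvol, Complex.ofReal_one, one_mul]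

end Coefficient

end Unramified

end DilationModel
end LocalFactors
end PerL34
end HodgeCM

end
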